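/-
Copyright (c) 2026. Released under the Apache 2.0 license.
-/
import Mathlib.Analysis.Complex.Cardinality
import Literature.NumberTheory.EllipticCurves.ModularCurve
import HarnessLib

/-!
# Parametrisations by `X₁(N)` and the Manin constant: `c_φ ∣ deg φ` for every `φ : X₁(N)_ℚ ↠ E`
# (Česnavičius–Neururer–Saha, JEMS 26 (2024), Thm. 1.1)

The source. K. Česnavičius, M. Neururer, A. Saha, *The Manin constant and the modular degree*,
J. Eur. Math. Soc. 26 (2024), no. 2, 573–637, doi:10.4171/jems/1367 (bib key
`CesnaviciusNeururerSaha2023`; held text `paper:arxiv-1911.09446` = arXiv v3, §1 = chunk p0003).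
Setting (§1, p0003 L3–L20): for an elliptic curve `E/ℚ` of conductor `N` and a level
`Γ₁(N) ⊂ Γ ⊂ Γ₀(N)` there is a surjection `φ : (X_Γ)_ℚ ↠ E`; "the `φ`-pullback of a Néron
differential `ω_E` is a nonzero multiple of the differential `ω_f ∈ H⁰((X_Γ)_ℚ, Ω¹)` associated to
the normalized newform `f`": `φ^*(ω_E) = c_φ · ω_f` for a unique `c_φ ∈ ℚ^×`, and "one knows that
`c_φ ∈ ℤ`" (Gabber; op. cit. Lemma `const-in-Z`; "`φ` determines only `±c_φ`"). THE PRINTED THEOREM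
(§1, first theorem of the Introduction, label `X1N-main` = Thm. 1.1; p0003 L34–L39), verbatim:
"For an elliptic curve `E` over `ℚ` of conductor `N`, every surjection `φ : X₁(N)_ℚ ↠ E` satisfies
`c_φ ∣ deg(φ)`." (No exceptional clause at `2`, `3`, in contrast to Thm. 1.2 for `X₀(N)`; the
footnote at L32: "In [Ste89], Stevens argued that minimal degree parametrizations by `X₁(N)_ℚ` are
the most natural ones, and he conjectured that `c_φ = ±1` for them" — a conjecture, not vendored.)

## Vocabulary added (definitions with bodies, mirroring `ModularCurve.lean` for `Γ₀(N)`)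

* `Y1 N = Γ₁(N) \ ℍ` (Mathlib `CongruenceSubgroup.Gamma1 N ≤ SL(2, ℤ)` acting on `ℍ`), `Y1.mk`,
  and the natural map `Y1.toY0 : Y₁(N) → Y₀(N)` (`Γ₁(N) ≤ Γ₀(N)`, Mathlib `Gamma1_in_Gamma0`).
* `periodLatticeGamma1 f = Λ₁(f) ⊆ ℂ`, for `f ∈ S₂(Γ₀(N))`: the subgroup generated by the periods
  `{∞, γ∞}_f = {τ, γτ}_f`, `γ ∈ Γ₁(N)` (`cuspSymbol` of `ModularSymbols.lean` restricted along
  `Γ₁(N) ≤ Γ₀(N)`), i.e. the group of periods of `ω_f = 2πi f(τ) dτ` over integral `1`-cycles on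
  `X₁(N)` (`γ ↦ {τ, γτ}` maps `Γ₁(N)` onto `H₁(X₁(N), ℤ)`; elliptic and parabolic elements give
  `0`).
  `Λ₁(f) ≤ Λ_f = periodLattice f` (`periodLatticeGamma1_le_periodLattice`). For the newform `f` of
  `E`, `ℂ/Λ₁(f)` is (a lattice rescaling of) Stevens' `X₁(N)`-optimal curve of the isogeny class
  [Stevens1989, §2], as `ℂ/Λ_f` is the `X₀(N)`-optimal one.
* `Gamma1ParametrizationData W N` — **`X₁(N)`-parametrisation data** of an elliptic curve `W/ℚ` at
  level `N`, the `Γ₁(N)` twin of the hypothesis structure `ModularParametrizationData W N`: the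
  newform `f` of `W` (on `Γ₀(N)`: trivial nebentypus; as a form on `Γ₁(N) ≤ Γ₀(N)` it is the same
  function, and `ω_f = 2πi f(τ) dτ = f(q) dq/q` at the cusp `∞`, of width `1` for every
  `Γ₁(N) ⊂ Γ ⊂ Γ₀(N)`), a Néron lattice `L` of the model `W` with its uniformisation
  `uniformize : ℂ →+ W(ℂ)` (kernel `L`, onto), an INTEGER `c` with `c Λ₁(f) ⊆ Λ_E` — the Manin
  constant of the parametrisation `φ_D(τ) = uniformize (c · 2πi ∫_{i∞}^τ f)`, which is
  `Γ₁(N)`-invariant (`φ_gamma1_smul`, proved from the C9 fact `eichlerIntegral_smul_sub`) — and the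
  degree `deg`: all but finitely many `P ∈ E(ℂ)` have exactly `deg` `Γ₁(N)`-orbits of preimages.

## Why data = surjections (faithfulness of the rendering)

(→) Given a surjection `φ : X₁(N)_ℚ ↠ E` (`E` given by a globally minimal `W`, so that
`ω_W = dx/(2y + a₁x + a₃)` is a Néron differential and `IsNeronLatticeOf` pins the Néron lattice
`Λ_E` with `ω_W ↔ dz`): the lift `Φ : ℍ → ℂ` of `φ` along `ℂ → ℂ/Λ_E ≅ E(ℂ)` has
`dΦ = φ^* dz = φ^* ω_E = c_φ · 2πi f(τ) dτ`, so `Φ(τ) = c_φ · 2πi ∫_{i∞}^τ f + z₀`;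
`Γ₁(N)`-invariance of `φ` gives `c_φ ({τ, γτ}_f) ∈ Λ_E` for `γ ∈ Γ₁(N)`, i.e.
`c_φ Λ₁(f) ⊆ Λ_E`; and the generic fibre of `τ ↦ uniformize (c_φ · 2πi ∫_{i∞}^τ f) = φ(τ) −
uniformize z₀` on `Y₁(N)` has `deg φ` points (translation is a bijection; `X₁(N) ∖ Y₁(N)` is the
finite set of cusps). So `φ` yields a datum with
`c = ±c_φ ∈ ℤ`, `deg = deg φ` — whether or not `φ(∞) = O`, and whichever cusp of `X₁(N)_ℚ` is
rational in the chosen `ℚ`-model.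
(←) Given a datum `D`: `φ_D = m_c ∘ π₁` with `π₁ : X₁(N) → A₁ := ℂ/Λ₁(f)` the Albanese map composed
with Stevens' optimal quotient `J₁(N) ↠ A₁` and `m_c : ℂ/Λ₁(f) → ℂ/Λ_E`, `z ↦ c z`; `c ∈ ℤ` is
REAL and both lattices are conjugation-stable (curves and differentials over `ℚ ⊂ ℝ`), so `m_c`
commutes with complex conjugation, hence is a `ℚ`-rational isogeny `A₁ → E` (`Gal(ℚ̄/ℚ)` acts on
`Hom_ℚ̄(A₁, E) ⊗ ℚ` trivially in the non-CM case and through `Gal(K/ℚ) = ⟨conj|_K⟩` in the CM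
case). Re-basing the Albanese map at a RATIONAL cusp `x₀ ∈ X₁(N)(ℚ)` (one of `0`, `∞` is rational in
either standard `ℚ`-model) changes `φ_D` by a translation of `E`, which alters neither `φ^* ω_E`
nor the degree. So every datum yields a surjection `φ' : X₁(N)_ℚ ↠ E` over `ℚ` with `c_{φ'} = ±D.c`
and `deg φ' = D.deg`, and Thm. 1.1 for `φ'` is exactly `D.c ∣ D.deg`. Hence the named fact below,
quantified over data of globally minimal models at the conductor level, is FAITHFUL to print.

## Contents

* `Y1`, `Y1.mk`, `Y1.mk_eq_mk_iff`, `Y1.toY0`; `periodLatticeGamma1`,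
  `periodLatticeGamma1_le_periodLattice`, `cuspSymbol_mem_periodLatticeGamma1`;
* `Gamma1ParametrizationData` with `φ`, `maninConstant`, `modularDegree`, `φ_gamma1_smul` (from
  `eichlerIntegral_smul_sub D.f`), `infinite_point`, `maninConstant_ne_zero` (all proved);
* the named fact `cesnaviciusNeururerSaha_thm_1_1` (statement only) and its corollary shape
  `not_dvd_maninConstant_of_not_dvd_modularDegree₁` (`p ∤ deg ⇒ p ∤ c`, proved from the fact).

## References
* [CesnaviciusNeururerSaha2023] K. Česnavičius, M. Neururer, A. Saha, *The Manin constant and the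
  modular degree*, J. Eur. Math. Soc. 26 (2024), no. 2, 573–637; arXiv:1911.09446, Thm. 1.1
  (`X1N-main`) and §1.
* [Stevens1989] G. Stevens, *Stickelberger elements and modular parametrizations of elliptic
  curves*, Invent. Math. 98 (1989), 75–106, §2 (parametrisations by `X₁(N)`, the optimal curve).
* [Manin1972] Ju. I. Manin, *Parabolic points and zeta functions of modular curves*, Izv. (1972),
  Prop. 1.4, Thm. 1.9 (`γ ↦ {τ, γτ}` onto `H₁`).
* J. E. Cremona, *Algorithms for modular elliptic curves*, 2nd ed. (1997), §2.10.
-/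

noncomputable section

open scoped MatrixGroups ModularForm

open CongruenceSubgroup UpperHalfPlane Complex

namespace Literature.NumberTheory.EllipticCurves.ModularForms

/-! ### The open modular curve `Y₁(N)` -/

section Curve

variable (N : ℕ)

/-- The **open modular curve** `Y₁(N) = Γ₁(N) \ ℍ`: the orbit space of Mathlib's congruence
subgroup `CongruenceSubgroup.Gamma1 N ≤ SL(2, ℤ)` acting on the upper half-plane (the `Γ₁(N)` twin
of `Y0 N`; Diamond–Shurman §2.1; Stevens 1989, §2). [folklore] -/
def Y1 : Type :=
  MulAction.orbitRel.Quotient (Gamma1 N) ℍ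

/-- The orbit map `ℍ → Y₁(N)`, `τ ↦ Γ₁(N) τ` (Diamond–Shurman §2.1). [folklore] -/
def Y1.mk (τ : ℍ) : Y1 N :=
  (Quotient.mk _ τ : MulAction.orbitRel.Quotient (Gamma1 N) ℍ)

/-- Two points of `ℍ` have the same image in `Y₁(N)` iff they are `Γ₁(N)`-equivalent
(Diamond–Shurman §2.1, the orbit space `Y(Γ) = Γ \ ℍ`). [cite: DiamondShurman2005, §2.1] -/
theorem Y1.mk_eq_mk_iff (τ τ' : ℍ) : Y1.mk N τ = Y1.mk N τ' ↔ ∃ γ : Gamma1 N, γ • τ' = τ :=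
  Quotient.eq (r := MulAction.orbitRel (Gamma1 N) ℍ)

/-- The orbit map `ℍ → Y₁(N)` is surjective (Diamond–Shurman §2.1).
[cite: DiamondShurman2005, §2.1] -/
theorem Y1.mk_surjective : Function.Surjective (Y1.mk N) :=
  Quotient.mk_surjective

/-- The natural map `Y₁(N) → Y₀(N)`, `Γ₁(N) τ ↦ Γ₀(N) τ`, induced by `Γ₁(N) ≤ Γ₀(N)` (Mathlib
`Gamma1_in_Gamma0`; Diamond–Shurman §2.1, the maps between modular curves). [folklore] -/
def Y1.toY0 : Y1 N → Y0 N :=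
  Quotient.map' id fun _ _ ⟨γ, h⟩ ↦ ⟨⟨(γ : SL(2, ℤ)), Gamma1_in_Gamma0 N γ.2⟩, h⟩

/-- `Y1.toY0` on orbits: `Γ₁(N) τ ↦ Γ₀(N) τ` (Diamond–Shurman §2.1; by construction).
[cite: DiamondShurman2005, §2.1] -/
@[simp] theorem Y1.toY0_mk (τ : ℍ) : Y1.toY0 N (Y1.mk N τ) = Y0.mk N τ := rfl

end Curve

/-! ### The `Γ₁(N)`-period lattice of a weight-`2` cusp form on `Γ₀(N)` -/

section Periods

variable {N : ℕ} (f : CuspForm (Gamma0 N) 2)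

/-- **The `Γ₁(N)`-period lattice** `Λ₁(f) ⊆ ℂ` of `f ∈ S₂(Γ₀(N))`: the subgroup generated by the
periods `{∞, γ∞}_f` (`cuspSymbol f γ`), `γ ∈ Γ₁(N) ≤ Γ₀(N)`; since `{∞, γ∞}_f = {τ, γτ}_f`
(`eichlerIntegral_smul_sub`) and `γ ↦ {τ, γτ}` maps `Γ₁(N)` onto `H₁(X₁(N), ℤ)` (Manin 1972,
Prop. 1.4, Thm. 1.9, for any finite-index level), this is the group of periods of
`ω_f = 2πi f(τ) dτ` over integral `1`-cycles on `X₁(N)`. For the newform of an elliptic curve it is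
a rank-`2` lattice and `ℂ/Λ₁(f)` is a rescaling of Stevens' `X₁(N)`-optimal curve (Stevens 1989,
§2). [cite: Manin1972, Prop. 1.4 / Thm. 1.9] -/
def periodLatticeGamma1 : AddSubgroup ℂ :=
  AddSubgroup.closure
    (Set.range fun γ : Gamma1 N ↦ cuspSymbol f ⟨(γ : SL(2, ℤ)), Gamma1_in_Gamma0 N γ.2⟩)

/-- `Λ₁(f) ≤ Λ_f`: every `Γ₁(N)`-period is a `Γ₀(N)`-period (`Γ₁(N) ≤ Γ₀(N)`; Manin 1972,
Prop. 1.4: the periods `{τ, γτ}` for `γ` in the level group). [cite: Manin1972, Prop. 1.4] -/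
theorem periodLatticeGamma1_le_periodLattice : periodLatticeGamma1 f ≤ periodLattice f :=
  AddSubgroup.closure_mono (by rintro _ ⟨γ, rfl⟩; exact ⟨_, rfl⟩)

/-- Each generator `{∞, γ∞}_f`, `γ ∈ Γ₁(N)`, lies in `Λ₁(f)` (Manin 1972, Prop. 1.4; by
construction). [cite: Manin1972, Prop. 1.4] -/
theorem cuspSymbol_mem_periodLatticeGamma1 (γ : Gamma1 N) :
    cuspSymbol f ⟨(γ : SL(2, ℤ)), Gamma1_in_Gamma0 N γ.2⟩ ∈ periodLatticeGamma1 f :=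
  AddSubgroup.subset_closure ⟨γ, rfl⟩

end Periods

/-! ### `X₁(N)`-parametrisation data -/

section Parametrization

variable (W : WeierstrassCurve ℚ) (N : ℕ) [NeZero N]

/-- **`X₁(N)`-parametrisation data** for an elliptic curve `W/ℚ` at level `N` — the `Γ₁(N)` twin
of the hypothesis structure `ModularParametrizationData W N` (same design, same field names where
they agree): the newform `f` of `W` (`IsNewformOf`; on `Γ₁(N) ≤ Γ₀(N)` the same function, with
`ω_f = 2πi f(τ) dτ` at the width-`1` cusp `∞`), a period pair `L` spanning the Néron lattice of the
model `W` with its uniformisation `uniformize : ℂ →+ W(ℂ)` (kernel `L`, onto, `℘`-formula off `L`),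
the **Manin constant** `c : ℤ` of the parametrisation, characterised by `c Λ₁(f) ⊆ Λ_E`
(`φ^* ω_E = c · ω_f`; `c ∈ ℤ` by Gabber / ČNS Lemma `const-in-Z`), and the **degree** `deg`: all but
finitely many `P ∈ E(ℂ)` have exactly `deg` `Γ₁(N)`-orbits `Γ₁(N)τ ∈ Y₁(N)` with
`uniformize (c · 2πi ∫_{i∞}^τ f) = P`. Every surjection `φ : X₁(N)_ℚ ↠ E` (for `W` globally
minimal) yields such a datum with `c = ±c_φ`, `deg = deg φ`, and conversely (module docstring,
"Why data = surjections") (ČNS §1; Stevens 1989, §2; Cremona §2.10).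
[cite: CesnaviciusNeururerSaha2023, §1] -/
structure Gamma1ParametrizationData where
  /-- The newform attached to `W` (trivial nebentypus, so a form on `Γ₀(N)`). -/
  f : CuspForm (Gamma0 N) 2
  /-- `f` is the newform of `W`: `aₙ(f) = aₙ(W)` for all `n`. -/
  isNewformOf : IsNewformOf W f
  /-- A period pair spanning the Néron lattice of the model `W`. -/
  L : PeriodPair
  /-- `g₂(L) = c₄/12`, `g₃(L) = c₆/216` for the model `W` base-changed to `ℂ`. -/
  isNeronLattice : IsNeronLatticeOf (W.baseChange ℂ) L
  /-- The complex uniformisation `ℂ → ℂ/Λ_E ≃ E(ℂ)` as a group homomorphism. -/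
  uniformize : ℂ →+ (W.baseChange ℂ).toAffine.Point
  /-- The kernel of the uniformisation is the Néron lattice. -/
  ker_uniformize : (uniformize.ker : Set ℂ) = L.lattice
  /-- The uniformisation is onto `E(ℂ)`. -/
  uniformize_surjective : Function.Surjective uniformize
  /-- Off the lattice the uniformisation is `z ↦ (℘(z) − b₂/12, (℘'(z) − a₁x − a₃)/2)`. -/
  uniformize_spec : ∀ z ∉ L.lattice, ∃ h,
    uniformize z = .some (W' := (W.baseChange ℂ).toAffine)
      (L.weierstrassP z - (W.baseChange ℂ).b₂ / 12)
      ((L.derivWeierstrassP z - (W.baseChange ℂ).a₁ * (L.weierstrassP z - (W.baseChange ℂ).b₂ / 12)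
        - (W.baseChange ℂ).a₃) / 2) h
  /-- The **Manin constant** of the `X₁(N)`-parametrisation. -/
  c : ℤ
  /-- `c Λ₁(f) ⊆ Λ_E`: the pull-back of the Néron differential along `X₁(N) → E` is
  `c · 2πi f(τ) dτ`. -/
  smul_periodLatticeGamma1_le : ∀ z ∈ periodLatticeGamma1 f, (c : ℂ) * z ∈ L.lattice
  /-- The **degree** of the `X₁(N)`-parametrisation. -/
  deg : ℕ
  /-- The degree is positive (the parametrisation is non-constant). -/
  deg_pos : 0 < deg
  /-- All but finitely many `P ∈ E(ℂ)` have exactly `deg` orbits `Γ₁(N)τ ∈ Y₁(N)` with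
  `uniformize (c · 2πi ∫_{i∞}^τ f) = P`. -/
  deg_spec : {P : (W.baseChange ℂ).toAffine.Point |
    Nat.card {y : Y1 N // ∃ τ : ℍ, Y1.mk N τ = y ∧
      uniformize ((c : ℂ) * eichlerIntegral f τ) = P} ≠ deg}.Finite

namespace Gamma1ParametrizationData

variable {W N} (D : Gamma1ParametrizationData W N)

/-- The **`X₁(N)`-parametrisation** `φ : ℍ → E(ℂ)`, `φ(τ) = uniformize (c · 2πi ∫_{i∞}^τ f(z) dz)`;
it is `Γ₁(N)`-invariant (`φ_gamma1_smul`) and so descends to `X₁(N) → E` (Stevens 1989, §2;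
Cremona §2.10). [folklore] -/
def φ (τ : ℍ) : (W.baseChange ℂ).toAffine.Point :=
  D.uniformize ((D.c : ℂ) * eichlerIntegral D.f τ)

/-- The **Manin constant** `c ∈ ℤ` of the `X₁(N)`-parametrisation: `φ^* ω_E = c · 2πi f(τ) dτ`,
i.e. `c Λ₁(f) ⊆ Λ_E` (ČNS §1: `c_φ`, "`φ` determines only `±c_φ`").
[cite: CesnaviciusNeururerSaha2023, §1] -/
def maninConstant : ℤ :=
  D.c

/-- The **degree** `deg φ` of the `X₁(N)`-parametrisation (ČNS §1).
[cite: CesnaviciusNeururerSaha2023, §1] -/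
def modularDegree : ℕ :=
  D.deg

/-- **`φ` is `Γ₁(N)`-invariant**: `φ(γτ) = φ(τ)` for `γ ∈ Γ₁(N)`, because
`2πi ∫_{i∞}^{γτ} f − 2πi ∫_{i∞}^{τ} f = {∞, γ∞}_f ∈ Λ₁(f)` (the C9 fact `eichlerIntegral_smul_sub`
for `D.f`, at `γ ∈ Γ₁(N) ≤ Γ₀(N)`), `c Λ₁(f) ⊆ Λ_E` and `Λ_E = ker uniformize` (Stevens 1989, §2;
Cremona §2.10). [cite: CremonaAlgorithms1997, §2.10] -/
theorem φ_gamma1_smul (h : eichlerIntegral_smul_sub D.f) (γ : Gamma1 N) (τ : ℍ) :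
    D.φ (γ • τ) = D.φ τ := by
  rw [← sub_eq_zero, φ, φ, ← map_sub, ← mul_sub, ← AddMonoidHom.mem_ker, ← SetLike.mem_coe,
    D.ker_uniformize, SetLike.mem_coe]
  have hγ : (γ • τ : ℍ) =
      ((⟨(γ : SL(2, ℤ)), Gamma1_in_Gamma0 N γ.2⟩ : Gamma0 N) : SL(2, ℤ)) • τ := rfl
  rw [hγ, h]
  exact D.smul_periodLatticeGamma1_le _ (cuspSymbol_mem_periodLatticeGamma1 D.f γ)

/-- `φ` is constant on `Γ₁(N)`-orbits, i.e. factors through `Y1.mk N`, given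
`eichlerIntegral_smul_sub D.f` (Stevens 1989, §2: the parametrisation `X₁(N) → E`; Cremona §2.10).
[cite: CremonaAlgorithms1997, §2.10] -/
theorem φ_eq_of_mk_eq_mk (h : eichlerIntegral_smul_sub D.f) {τ τ' : ℍ}
    (hmk : Y1.mk N τ = Y1.mk N τ') : D.φ τ = D.φ τ' := by
  obtain ⟨γ, rfl⟩ := (Y1.mk_eq_mk_iff N τ τ').mp hmk
  exact D.φ_gamma1_smul h γ τ'

/-- `E(ℂ)` is infinite: `uniformize : ℂ →+ E(ℂ)` is onto with kernel the (countable) lattice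
`Λ_E`, and `ℂ` is uncountable (as for `ModularParametrizationData.infinite_point`; Silverman AEC
VI.5.1, `E(ℂ) ≅ ℂ/Λ`). [cite: SilvermanAEC2009, Thm. VI.5.1] -/
theorem infinite_point (D : Gamma1ParametrizationData W N) :
    Infinite (W.baseChange ℂ).toAffine.Point := by
  rw [← not_finite_iff_infinite]
  intro hfin
  have hΛ : (D.L.lattice : Set ℂ).Countable := countable_of_Lindelof_of_discrete (X := D.L.lattice)
  refine not_countable_complex
    ((Set.countable_iUnion fun n : ℕ ↦ hΛ.image fun l : ℂ ↦ l / (n : ℂ)).mono fun z _ ↦ ?_)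
  obtain ⟨n, hn, hnz⟩ := (isOfFinAddOrder_of_finite (D.uniformize z)).exists_nsmul_eq_zero
  rw [← map_nsmul, ← AddMonoidHom.mem_ker, ← SetLike.mem_coe, D.ker_uniformize, SetLike.mem_coe,
    nsmul_eq_mul] at hnz
  have hn' : (n : ℂ) ≠ 0 := by exact_mod_cast hn.ne'
  exact Set.mem_iUnion.mpr ⟨n, _, hnz, mul_div_cancel_left₀ z hn'⟩

/-- **The Manin constant of an `X₁(N)`-parametrisation datum is non-zero**: if `c = 0` then
`φ ≡ O`, so `E(ℂ) ⊆ (range φ)ᶜ ∪ {O}` would be finite, contradicting `infinite_point` (ČNS §1: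
`c_φ ∈ ℚ^×`). [cite: CesnaviciusNeururerSaha2023, §1] -/
theorem maninConstant_ne_zero : D.maninConstant ≠ 0 := by
  intro hc
  have hφ : ∀ τ, D.φ τ = 0 := fun τ ↦ by
    have hc' : D.c = 0 := hc
    simp [φ, hc']
  -- all but finitely many points of `E(ℂ)` are values of `φ` (`deg_spec` with `0 < deg`)
  have hrange : (Set.range D.φ)ᶜ.Finite := by
    refine D.deg_spec.subset fun P hP ↦ ?_
    have : IsEmpty {y : Y1 N // ∃ τ : ℍ, Y1.mk N τ = y ∧ D.φ τ = P} :=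
      ⟨fun ⟨_, τ, _, hτ⟩ ↦ hP ⟨τ, hτ⟩⟩
    change Nat.card {y : Y1 N // ∃ τ : ℍ, Y1.mk N τ = y ∧ D.φ τ = P} ≠ D.deg
    rw [Nat.card_of_isEmpty]
    exact D.deg_pos.ne
  refine D.infinite_point.not_finite (Set.finite_univ_iff.mp
    ((hrange.union (Set.finite_singleton 0)).subset fun P _ ↦ ?_))
  by_cases hP : P = 0
  · exact Or.inr (Set.mem_singleton_iff.mpr hP)
  · exact Or.inl fun ⟨τ, hτ⟩ ↦ hP (hτ.symm.trans (hφ τ))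

end Gamma1ParametrizationData

/-- **From an `X₀(N)`-datum's lattice condition to the `X₁(N)` one**: `c Λ_f ⊆ Λ_E` implies
`c Λ₁(f) ⊆ Λ_E` (`Λ₁(f) ≤ Λ_f`), i.e. composing `X₁(N) → X₀(N) → E` keeps the Manin constant
(ČNS §1: "any `φ` factors through an optimal one"; the degree is multiplied by
`deg(X₁(N) → X₀(N))`, not recorded here). [cite: CesnaviciusNeururerSaha2023, §1] -/
theorem ModularParametrizationData.smul_periodLatticeGamma1_le (D : ModularParametrizationData W N)
    (z : ℂ) (hz : z ∈ periodLatticeGamma1 D.f) : (D.c : ℂ) * z ∈ D.L.lattice :=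
  D.smul_periodLattice_le z (periodLatticeGamma1_le_periodLattice D.f hz)

/-! ### ČNS Thm. 1.1 -/

/-- **Česnavičius–Neururer–Saha 2024, Thm. 1.1 (the Manin constant of an `X₁(N)`-parametrisation
divides its degree).** Printed (JEMS 26 (2024) 573–637, Thm. 1.1; arXiv:1911.09446 §1, label
`X1N-main`), verbatim: "For an elliptic curve `E` over `ℚ` of conductor `N`, every surjection
`φ : X₁(N)_ℚ ↠ E` satisfies `c_φ ∣ deg(φ)`." Here `φ^*(ω_E) = c_φ · ω_f`, `ω_E` a Néron
differential, `ω_f` the differential of the normalised newform `f` of `E`, `c_φ ∈ ℤ`. Rendering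
(module docstring, "Why data = surjections"): for every globally minimal model `W/ℚ` of an elliptic
curve, `N = W.conductorNorm ℤ` its conductor, and every `X₁(N)`-parametrisation datum `D` of `W`
at level `N` — which is, up to a translation of `E`, a surjection `φ' : X₁(N)_ℚ ↠ E` over `ℚ` with
`c_{φ'} = ±D.c` and `deg φ' = D.deg`, and every surjection arises so —: `D.c ∣ D.deg`. No
optimality hypothesis and, unlike Thm. 1.2 for `X₀(N)`, no exceptional clause at `2` or `3`.
FAITHFUL to print. Named fact (statement only). [cite: CesnaviciusNeururerSaha2023, Thm. 1.1] -/
def cesnaviciusNeururerSaha_thm_1_1 : Prop :=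
  ∀ (W : WeierstrassCurve ℚ) [W.IsElliptic] [W.IsGloballyMinimal] [NeZero (W.conductorNorm ℤ)]
    (D : Gamma1ParametrizationData W (W.conductorNorm ℤ)),
    D.maninConstant ∣ (D.modularDegree : ℤ)

/-- **Corollary shape (`p ∤ deg φ ⟹ p ∤ c_φ` for `X₁(N)`-parametrisations, at EVERY `p`,
including `2` and `3`)**: under the fact, for an `X₁(N)`-datum `D` of a globally minimal `W` at the
conductor level and any `p : ℕ` not dividing `D.deg`, `p ∤ D.c`.
[cite: CesnaviciusNeururerSaha2023, Thm. 1.1] -/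
theorem not_dvd_maninConstant_of_not_dvd_modularDegree₁ (h : cesnaviciusNeururerSaha_thm_1_1)
    (W : WeierstrassCurve ℚ) [W.IsElliptic] [W.IsGloballyMinimal] [NeZero (W.conductorNorm ℤ)]
    (D : Gamma1ParametrizationData W (W.conductorNorm ℤ)) {p : ℕ}
    (hdeg : ¬ p ∣ D.modularDegree) : ¬ (p : ℤ) ∣ D.c := fun hpc ↦
  hdeg (Int.natCast_dvd_natCast.mp (hpc.trans (h W D)))

/-- **Valuation form of Thm. 1.1**: under the fact, `val_p(c) ≤ val_p(deg)` at every prime `p`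
for every `X₁(N)`-datum of a globally minimal `W` at the conductor level (`c ≠ 0`,
`maninConstant_ne_zero`; `deg > 0`). [cite: CesnaviciusNeururerSaha2023, Thm. 1.1] -/
theorem padicValInt_maninConstant_le_modularDegree₁ (h : cesnaviciusNeururerSaha_thm_1_1)
    (W : WeierstrassCurve ℚ) [W.IsElliptic] [W.IsGloballyMinimal] [NeZero (W.conductorNorm ℤ)]
    (D : Gamma1ParametrizationData W (W.conductorNorm ℤ)) (p : ℕ) [Fact p.Prime] :
    padicValInt p D.maninConstant ≤ padicValNat p D.modularDegree := by
  have hdvd : D.maninConstant.natAbs ∣ D.modularDegree := Int.dvd_natCast.mp (h W D)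
  have hdeg : D.modularDegree ≠ 0 := D.deg_pos.ne'
  rw [padicValInt, ← padicValNat_dvd_iff_le hdeg]
  exact (pow_padicValNat_dvd).trans hdvd

end Parametrization

end Literature.NumberTheory.EllipticCurves.ModularForms

end
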